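import Summits.CriticalPhenomena.PercolationContinuityZ3.Theorems.Transplant.FKConnectivityAllQAntipodalTwoSpineCells
import Summits.CriticalPhenomena.PercolationContinuityZ3.Theorems.Transplant.FKConnectivityAllQAntipodalX2SpineRows
import HarnessLib

/-!
# Connectivity correlation inequalities for `φ_{w,q}` — TWO-SPINE word model: gen 13's WORD-HALL `ι` in the two-spine vocabulary

Helper file (`--supports stmt-CriticalPhenomena-4575`), FK sub-lane `prim-bschramm-fk-2` (gen 15); builds on p205010 (kernel theorem,
internal audit signed; external expert review pending).  No named facts, no sorries, standard axioms.

Memo `bschramm/FROM-fk-2-g15-TWO-SPINE.md` §11 (R2) / §12 (V2): the degree-1 atoms of a critical cell are sent along gen 13's involution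
`ι = FK.X2Word.sigmaPhi`.  This file restates `FK.X2Word.sigma_wordHall` in the two-spine row vocabulary (`rowC`, `rowDel`, `rowCorr` of
`…TwoSpineDefs`): the loser/winner tests (`sIsLoser_iff`, `sIsWinner_iff`), and **`iota_spec`** — the image of an X2-loser conducts in `α`,
has `δ(ᾱ) = 1` (so the degree-1 atom slot exists), keeps the total `corr` (`rowCorr_add_sRuns` + `nP` preserved under flips), lies above the
word in the flip order, and `ι` is injective on X2-losers.
[cite: Grimmett2006, §3.9 (p. 63)]
-/

namespace Summit.CriticalPhenomena.PercolationContinuityZ3.Theorems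

namespace FK

namespace TwoSpine

open X2Word

/-! ### gen 13's word-Hall `ι = sigmaPhi` in the two-spine vocabulary (the degree-1 atom map of the rule, memo §11 R2 / §12 V2) -/

/-- Total `corr` of the two rows from `nP` and `sRuns`: `corr α + corr ᾱ + sRuns = nP`. [folklore] -/
theorem rowCorr_add_sRuns (w : List SLetter) : rowCorr (sRowA w) + rowCorr (sRowB w) + sRuns w = nP w := by
  unfold rowCorr sRuns nP
  have h1 := adjP_add_runsP (sRowA w); have h2 := adjP_add_runsP (sRowB w)
  omega

/-- The X2-loser test in the two-spine vocabulary: `ᾱ` conducts, `δ(α) = 1`, and not (`α` conducts and `δ(ᾱ) = 1`). [folklore] -/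
theorem sIsLoser_iff (u : List SLetter) :
    sIsLoser u = (rowC (sRowB u) && (rowDel (sRowA u) == 1) && !(rowC (sRowA u) && (rowDel (sRowB u) == 1))) := by
  unfold sIsLoser rowC rowDel
  cases headP (sRowA u) <;> cases headP (sRowB u) <;> cases lastP (sRowA u) <;> cases lastP (sRowB u) <;> rfl

/-- The X2-winner test in the two-spine vocabulary: `α` conducts, `δ(ᾱ) = 1`, and not (`ᾱ` conducts and `δ(α) = 1`). [folklore] -/
theorem sIsWinner_iff (u : List SLetter) :
    sIsWinner u = (rowC (sRowA u) && (rowDel (sRowB u) == 1) && !(rowC (sRowB u) && (rowDel (sRowA u) == 1))) := by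
  unfold sIsWinner rowC rowDel
  cases headP (sRowA u) <;> cases headP (sRowB u) <;> cases lastP (sRowA u) <;> cases lastP (sRowB u) <;> rfl

/-- **`ι` on an X2-loser**: the image conducts in `α`, has `δ(ᾱ) = 1` (so its degree-1 atom slots exist), the same total `corr`, lies
above the word in the flip order, and `ι` is injective on X2-losers (gen 13's `sigma_wordHall`, restated). [folklore] -/
theorem iota_spec {u : List SLetter} (hu : sIsLoser u = true) :
    rowC (sRowA (sigmaPhi u)) = true ∧ rowDel (sRowB (sigmaPhi u)) = 1 ∧
    rowCorr (sRowA (sigmaPhi u)) + rowCorr (sRowB (sigmaPhi u)) = rowCorr (sRowA u) + rowCorr (sRowB u) ∧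
    List.Forall₂ (fun a b : SLetter => b = a ∨ (a.2 = (false, true) ∧ b = (a.1, true, false))) u (sigmaPhi u) ∧
    (∀ u', sIsLoser u' = true → sigmaPhi u' = sigmaPhi u → u' = u) := by
  obtain ⟨hwin, hruns, hflip, hinj⟩ := sigma_wordHall u hu
  have hw := hwin
  rw [sIsWinner_iff] at hw
  simp only [Bool.and_eq_true, beq_iff_eq, Bool.not_eq_true'] at hw
  refine ⟨hw.1.1, hw.1.2, ?_, hflip, hinj⟩
  have h1 := rowCorr_add_sRuns (sigmaPhi u); have h2 := rowCorr_add_sRuns u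
  have hn : nP (sigmaPhi u) = nP u := nP_eq_of_forall₂_flip hflip
  omega

end TwoSpine

end FK

end Summit.CriticalPhenomena.PercolationContinuityZ3.Theorems
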